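import Literature.NumberTheory.IwasawaTheory.Greenberg2006.TwistDeformationLEO
import Literature.NumberTheory.IwasawaTheory.Greenberg2006.InducedCohomologyComparisonHolds
import HarnessLib

/-!
# The ONE-variable twist deformation `𝐃₁ = bigRep κ̄ ρ₀` IS Serre's induced module: `Hⁱ(K_Σ/K, 𝐃₁) ≃+ Hⁱ(K_Σ/K_∞, A)`
# in every degree (Greenberg 2006 Thm. 3 for a single `ℤ_p`-extension; helper for stmt-BirchSwinnertonDyer-19032)
# (cell `bsd-eis`, seat `bsd-line-x1-p1-w2` gen 4; crux 2 `GoodLatticeBDPValue`, line `halves`, V21 road input WL)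

HONEST FRAMING (cell `bsd-eis`, run/shared/lean/pub/bsd-eis/): Galois-cohomological plumbing (no definition, no
named fact, no `sorry`, no `Theses` import); nothing about any curve is asserted; BSD / IMC2 / KY Thm. 1.4.1 are proved
for NO curve here. Helper `--supports stmt-BirchSwinnertonDyer-19032`; closes no registered stub.

## What

The tree discharged Greenberg 2006 Thm. 3 (`Hⁱ(K_Σ/K, 𝐃) ≃+ Hⁱ(K_Σ/K̃_∞, A)`, Λ-free, every degree) for the TWO-variable
deformation `twistDeformation S hS κ₁ κ₂ ρ₀ = IndModule₂` over the `ℤ_p²`-tower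
(`InducedCohomologyVanishing` §3 + `InducedCohomologyComparisonHolds`: model isomorphism `𝐃 ≃ M_G^H(A)` ∘ Serre's
Shapiro isomorphism `shapiroAddEquiv` ∘ change of scalars). The V21 road of crux 2 (LEAD g4 memo
`Cruxes/GoodLatticeBDPValue/Lines/halves-imprimLambda-index-road.md`) lives on the ANTICYCLOTOMIC LINE: one
`ℤ_p`-extension `κ`, `K_∞ = K̄^{ker κ}`, `G = Gal(K_Σ/K_∞) = galoisGroupAbove S κ.kerSubgroup`, and the cell's `K`-side
object is the ONE-variable deformation `𝐃₁ = bigRep (κ.liftUnramifiedOutside S hS) ρ₀` on the module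
`BigRepModule 𝒪 p A` of smooth `p`-primary functions `ℤ_p → A` (`AnticyclotomicBigGaloisRep`; LEAD g2's road (A)
files `…AcTwistDeformation*`). THIS FILE is the `m = 1` analogue, written WITHOUT new definitions (the Shapiro map
`Φ ↦ (g ↦ ρ₀(g)(Φ(−κ̄ g)))` is characterised by its formula and produced by `∃`):

* §1 `mem_galoisGroupAbove_kerSubgroup_iff` (`g ∈ Gal(K_Σ/K_∞) ↔ κ̄ g = 1`), `isClosed_galoisGroupAbove_kerSubgroup`,
  the projection `g ↦ −κ̄ g` (continuous, onto, a quotient map: `isQuotientMap_neg_liftUnramifiedOutside`).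
* §2 `exists_shapiroMap` — an additive `F : BigRepModule 𝒪 p A →+ M_G^H(A)` (`coindModule` of `ρ₀|_H` over `ℤ`) with
  `F(Φ)(g) = ρ₀(g)(Φ(−κ̄ g))`; for ANY `F` with this formula: `shapiroMap_injective`, `shapiroMap_surjective` (`A`
  `p`-primary: the preimage of `a*` is the smooth function `−κ̄ g ↦ ρ₀(g)⁻¹ a*(g)`), `shapiroMap_bigRep` (equivariance:
  Castella's `ρ₀ ⊗ Ψ⁻¹` ↔ Serre's right translation).
* §3 **`nonempty_H_bigRep_addEquiv_above`**: `Hⁱ(G_{K,S}, 𝐃₁) ≃+ Hⁱ(Gal(K_Σ/K_∞), A)` for every `i`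
  (`(bigRep (κ.liftUnramifiedOutside S hS) ρ₀).H i ≃+ (ρ₀.restrict (galoisGroupAboveSubtype S κ.kerSubgroup)).H i`),
  and the vanishing transports **`subsingleton_H_above_of_subsingleton_H_bigRep`** / `…_iff`.

Use (this seat's next file `…WeakLeopoldtAbove`): with `…WeakLeopoldtDescentAlgebra` (corank `0` ⟹ `H²(K_Σ/K, 𝐃₁) = 0`
for cofree `𝐃₁`, `cd_p(G_{K,Σ}) ≤ 2`) it turns LEAD g2's / w3 g3's `HasCorank Λ ((bigRep κ̄ ρ₀).H 2) 0` into
WL_A: `H²(Gal(K_Σ/K_∞), A) = 0` on the anticyclotomic line.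

References: [Greenberg2006] Thm. 3 p. 342 (statement), p. 341 L12–47 (set-up); [Lim2012PoitouTate] Prop. 5.2.2, Lemma
5.3.1 (proof in print); [SerreGaloisCohomology1997] I §2.5 Prop. 10 (Shapiro); [SkinnerUrban2014] Prop. 3.2.3 (the
co-induced model `T ⊗ Λ^*(Ψ⁻¹)`); [Castella2018] §2.1.
-/

set_option autoImplicit false
set_option linter.dupNamespace false -- the summit namespace `…BirchSwinnertonDyer.BirchSwinnertonDyer.Theorems` (Sub = Summit, D-0017) trips it

noncomputable section

open scoped Classical
open NumberField IsDedekindDomain Field CategoryTheory Multiplicative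
open Literature.NumberTheory.GaloisRepresentations
open Literature.NumberTheory.EllipticCurves (ZpExtension IsSmoothOfLevel BigRepModule bigRepSubmodule bigRep
  bigRep_apply_apply)
open Literature.NumberTheory.EllipticCurves.BigRepModule (continuous_coe exists_isSmoothOfLevel_of_continuous
  exists_uniform_pow_smul_eq_zero)
open Literature.NumberTheory.IwasawaTheory.Greenberg2016 Literature.NumberTheory.IwasawaTheory.Greenberg2006

namespace Summit.BirchSwinnertonDyer.BirchSwinnertonDyer.Theorems.AcTwistDeformationShapiroH

/-! ## §1 The tower subgroup `H = Gal(K_Σ/K_∞) = galoisGroupAbove S (ker κ)` and the projection `g ↦ −κ̄ g` -/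

section Tower

variable {K : Type} [Field K] [NumberField K] (S : Set (HeightOneSpectrum (𝓞 K))) {p : ℕ} [Fact p.Prime]
  (hS : ∀ v : HeightOneSpectrum (𝓞 K), ((p : ℕ) : 𝓞 K) ∈ v.asIdeal → v ∈ S)
  (κ : ZpExtension K p)

/-- Membership in `Gal(K_Σ/K_∞) ≤ G_{K,S}`: the kernel of the descended character `κ̄`.
[cite: Greenberg2006, p. 341 L39–45, p. 342 L2–4] -/
theorem mem_galoisGroupAbove_kerSubgroup_iff (g : GaloisGroupUnramifiedOutside K S) :
    g ∈ galoisGroupAbove S κ.kerSubgroup ↔ κ.liftUnramifiedOutside S hS g = 1 := by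
  constructor
  · intro hg
    obtain ⟨σ, hσ, rfl⟩ := (mem_galoisGroupAbove_iff S _ g).1 hg
    rw [ZpExtension.mem_kerSubgroup] at hσ
    rw [ZpExtension.liftUnramifiedOutside_mk]
    exact hσ
  · intro h1
    obtain ⟨σ, rfl⟩ := toUnramifiedQuot_surjective K S g
    exact (mem_galoisGroupAbove_iff S _ _).2 ⟨σ, ZpExtension.mem_kerSubgroup.2 h1, rfl⟩

omit [NumberField K] in
/-- `ker κ ≤ Γ_K` is closed (`κ` is continuous into the Hausdorff `ℤ_p`). [cite: Greenberg2006, p. 341 L39–47] -/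
theorem isClosed_kerSubgroup :
    IsClosed ((κ.kerSubgroup : Subgroup (absoluteGaloisGroup K)) : Set (absoluteGaloisGroup K)) := by
  have : ((κ.kerSubgroup : Subgroup (absoluteGaloisGroup K)) : Set (absoluteGaloisGroup K)) = κ ⁻¹' {1} := by
    ext σ; simp
  rw [this]
  exact isClosed_singleton.preimage (map_continuous κ)

/-- `Gal(K_Σ/K_∞)` is closed in `G_{K,S}`. [cite: Greenberg2006, p. 341 L12–16] -/
theorem isClosed_galoisGroupAbove_kerSubgroup :
    IsClosed ((galoisGroupAbove S κ.kerSubgroup : Subgroup (GaloisGroupUnramifiedOutside K S)) :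
      Set (GaloisGroupUnramifiedOutside K S)) :=
  isClosed_galoisGroupAbove S κ.kerSubgroup (isClosed_kerSubgroup κ)

/-- The projection `g ↦ −κ̄ g : G_{K,S} → ℤ_p` (the sign is Greenberg's / Castella's `ρ₀ ⊗ κ⁻¹`) is continuous.
[cite: Greenberg2006, p. 342 L2–6] -/
theorem continuous_neg_liftUnramifiedOutside :
    Continuous fun g : GaloisGroupUnramifiedOutside K S ↦ -(κ.liftUnramifiedOutside S hS g).toAdd :=
  (continuous_toAdd.comp (map_continuous _)).neg

/-- The projection `g ↦ −κ̄ g` is onto `ℤ_p` (`κ` is). [cite: Greenberg2006, p. 341 L24–27] -/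
theorem neg_liftUnramifiedOutside_surjective :
    Function.Surjective fun g : GaloisGroupUnramifiedOutside K S ↦ -(κ.liftUnramifiedOutside S hS g).toAdd := by
  intro x
  obtain ⟨g, hg⟩ := κ.liftUnramifiedOutside_surjective S hS (ofAdd (-x))
  refine ⟨g, ?_⟩
  change -(κ.liftUnramifiedOutside S hS g).toAdd = x
  rw [hg, toAdd_ofAdd, neg_neg]

/-- Two elements with the same projection differ by an element of `H = Gal(K_Σ/K_∞)`. [folklore] -/
theorem mul_inv_mem_galoisGroupAbove_of_eq {g g' : GaloisGroupUnramifiedOutside K S}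
    (h : -(κ.liftUnramifiedOutside S hS g).toAdd = -(κ.liftUnramifiedOutside S hS g').toAdd) :
    g' * g⁻¹ ∈ galoisGroupAbove S κ.kerSubgroup := by
  have h1 : κ.liftUnramifiedOutside S hS g = κ.liftUnramifiedOutside S hS g' :=
    toAdd.injective (neg_injective h)
  rw [mem_galoisGroupAbove_kerSubgroup_iff S hS κ, map_mul, map_inv, ← h1, mul_inv_cancel]

/-- The projection `G_{K,S} → ℤ_p` is a quotient map (continuous surjection from a compact space to a Hausdorff one).
[folklore] -/
theorem isQuotientMap_neg_liftUnramifiedOutside :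
    Topology.IsQuotientMap fun g : GaloisGroupUnramifiedOutside K S ↦ -(κ.liftUnramifiedOutside S hS g).toAdd :=
  ((continuous_neg_liftUnramifiedOutside S hS κ).isClosedMap).isQuotientMap
    (continuous_neg_liftUnramifiedOutside S hS κ) (neg_liftUnramifiedOutside_surjective S hS κ)

end Tower

/-! ## §2 The Shapiro map `𝐃₁ → M_G^H(A)`, `Φ ↦ (g ↦ ρ₀(g)(Φ(−κ̄ g)))`: existence, injectivity, surjectivity, equivariance -/

section Model

variable {K : Type} [Field K] [NumberField K] (S : Set (HeightOneSpectrum (𝓞 K))) {p : ℕ} [Fact p.Prime]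
  (hS : ∀ v : HeightOneSpectrum (𝓞 K), ((p : ℕ) : 𝓞 K) ∈ v.asIdeal → v ∈ S)
  (κ : ZpExtension K p)
  {𝒪 : Type} [CommRing 𝒪] [TopologicalSpace 𝒪] {A : Type} [AddCommGroup A] [Module 𝒪 A]
  [TopologicalSpace A] [DiscreteTopology A]
  (ρ₀ : ContinuousRep (GaloisGroupUnramifiedOutside K S) 𝒪 A)

/-- The function `g ↦ ρ₀(g)(Φ(−κ̄ g))` attached to `Φ ∈ 𝐃₁` is continuous (`A` discrete, `Φ` locally constant, the
action jointly continuous). [cite: Greenberg2006, p. 342 L5–11] [cite: SkinnerUrban2014, Prop. 3.2.3 (proof)] -/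
theorem continuous_shapiroFun (Φ : BigRepModule 𝒪 p A) :
    Continuous fun g : GaloisGroupUnramifiedOutside K S ↦ ρ₀ g (Φ (-(κ.liftUnramifiedOutside S hS g).toAdd)) :=
  ρ₀.continuous_smul.comp (continuous_id.prodMk
    ((continuous_coe Φ).comp (continuous_neg_liftUnramifiedOutside S hS κ)))

/-- `g ↦ ρ₀(g)(Φ(−κ̄ g))` lies in Serre's induced module `M_G^H(A)`: `a*(s g) = s · a*(g)` for `s ∈ H` (`κ̄ s = 0`).
[cite: SerreGaloisCohomology1997, I §2.5] -/
theorem shapiroFun_mem (Φ : BigRepModule 𝒪 p A) :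
    (⟨_, continuous_shapiroFun S hS κ ρ₀ Φ⟩ : C(GaloisGroupUnramifiedOutside K S, A)) ∈
      coindModule ((ρ₀.restrict (galoisGroupAboveSubtype S κ.kerSubgroup)).restrictScalars ℤ) := by
  rw [mem_coind_iff]
  intro s x
  have hs := (mem_galoisGroupAbove_kerSubgroup_iff S hS κ (s : GaloisGroupUnramifiedOutside K S)).1 s.2
  change ρ₀ ((s : GaloisGroupUnramifiedOutside K S) * x)
      (Φ (-(κ.liftUnramifiedOutside S hS ((s : GaloisGroupUnramifiedOutside K S) * x)).toAdd)) =
    ρ₀ (s : GaloisGroupUnramifiedOutside K S) (ρ₀ x (Φ (-(κ.liftUnramifiedOutside S hS x).toAdd)))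
  simp only [map_mul, hs, one_mul, Module.End.mul_apply]

/-- **The Shapiro map exists**: an additive `F : 𝐃₁ → M_G^H(A)` with `F(Φ)(g) = ρ₀(g)(Φ(−κ̄ g))`.
[cite: Greenberg2006, Thm. 3 p. 342] [cite: SerreGaloisCohomology1997, I §2.5] -/
theorem exists_shapiroMap :
    ∃ F : BigRepModule 𝒪 p A →+
        coindModule ((ρ₀.restrict (galoisGroupAboveSubtype S κ.kerSubgroup)).restrictScalars ℤ),
      ∀ (Φ : BigRepModule 𝒪 p A) (g : GaloisGroupUnramifiedOutside K S),
        ((F Φ : coindModule _) : C(GaloisGroupUnramifiedOutside K S, A)) g =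
          ρ₀ g (Φ (-(κ.liftUnramifiedOutside S hS g).toAdd)) := by
  refine ⟨{ toFun := fun Φ ↦ ⟨⟨_, continuous_shapiroFun S hS κ ρ₀ Φ⟩, shapiroFun_mem S hS κ ρ₀ Φ⟩
            map_zero' := ?_
            map_add' := fun Φ Ψ ↦ ?_ }, fun Φ g ↦ rfl⟩
  · apply Subtype.ext
    ext g
    change ρ₀ g ((0 : BigRepModule 𝒪 p A) _) = 0
    rw [BigRepModule.zero_apply, map_zero]
  · apply Subtype.ext
    ext g
    change ρ₀ g ((Φ + Ψ) _) = ρ₀ g (Φ _) + ρ₀ g (Ψ _)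
    rw [BigRepModule.add_apply, map_add]

variable {S hS κ ρ₀}

/-- **The Shapiro map is injective** (half of "`𝐃₁ = Ind_{K_∞/K}(A)`": the value `Φ(x)` is read at any `g` with
`−κ̄ g = x`). [cite: Greenberg2006, p. 342 L8–11 (`𝒟 = Ind_{K_∞/K}(D)`)]
[cite: Lim2012PoitouTate, §5.1 p. 17 (`F_Γ(M) = lim→_U Hom_R(R[Γ/U], M)`, locally constant functions on `Γ`)] -/
theorem shapiroMap_injective
    (F : BigRepModule 𝒪 p A →+ coindModule ((ρ₀.restrict (galoisGroupAboveSubtype S κ.kerSubgroup)).restrictScalars ℤ))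
    (hF : ∀ (Φ : BigRepModule 𝒪 p A) (g : GaloisGroupUnramifiedOutside K S),
      ((F Φ : coindModule _) : C(GaloisGroupUnramifiedOutside K S, A)) g =
        ρ₀ g (Φ (-(κ.liftUnramifiedOutside S hS g).toAdd))) :
    Function.Injective F := by
  rw [injective_iff_map_eq_zero]
  intro Φ hΦ
  apply BigRepModule.ext
  intro x
  obtain ⟨g, hg⟩ := neg_liftUnramifiedOutside_surjective S hS κ x
  have h := congrArg (fun f : coindModule ((ρ₀.restrict (galoisGroupAboveSubtype S κ.kerSubgroup)).restrictScalars ℤ) ↦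
    (f : C(GaloisGroupUnramifiedOutside K S, A)) g) hΦ
  simp only [hF, Submodule.coe_zero, ContinuousMap.zero_apply] at h
  change -(κ.liftUnramifiedOutside S hS g).toAdd = x at hg
  rw [hg] at h
  have : ρ₀ g⁻¹ (ρ₀ g (Φ x)) = 0 := by rw [h, map_zero]
  rwa [← Module.End.mul_apply, ← map_mul, inv_mul_cancel, map_one, Module.End.one_apply,
    ← BigRepModule.zero_apply (𝒪 := 𝒪) (p := p) x] at this

/-- **The Shapiro map is surjective** when `A` is `p`-primary: `a* ∈ M_G^H(A)` is the image of the smooth function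
`F` with `F(−κ̄ g) = ρ₀(g)⁻¹ a*(g)` (well defined on `H`-cosets; continuous because the projection is a quotient map;
smooth of some level and uniformly `p`-power torsion as a continuous function on the compact `ℤ_p` into the discrete
`A`). [cite: Greenberg2006, p. 342 L8–11 (`𝒟 = Ind_{K_∞/K}(D)`)]
[cite: Lim2012PoitouTate, §5.1 p. 17 (`F_Γ(M) = lim→_U Hom_R(R[Γ/U], M)`, locally constant functions on `Γ`)] -/
theorem shapiroMap_surjective (hA : ∀ a : A, ∃ n : ℕ, (p ^ n : ℤ) • a = 0)
    (F : BigRepModule 𝒪 p A →+ coindModule ((ρ₀.restrict (galoisGroupAboveSubtype S κ.kerSubgroup)).restrictScalars ℤ))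
    (hF : ∀ (Φ : BigRepModule 𝒪 p A) (g : GaloisGroupUnramifiedOutside K S),
      ((F Φ : coindModule _) : C(GaloisGroupUnramifiedOutside K S, A)) g =
        ρ₀ g (Φ (-(κ.liftUnramifiedOutside S hS g).toAdd))) :
    Function.Surjective F := by
  intro f
  -- the descended function `g ↦ ρ₀(g)⁻¹ a*(g)`, continuous and constant on `H`-cosets
  let π : GaloisGroupUnramifiedOutside K S → ℤ_[p] := fun g ↦ -(κ.liftUnramifiedOutside S hS g).toAdd
  have hπ : Function.Surjective π := neg_liftUnramifiedOutside_surjective S hS κ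
  let d : GaloisGroupUnramifiedOutside K S → A := fun g ↦ ρ₀ g⁻¹ ((f : C(GaloisGroupUnramifiedOutside K S, A)) g)
  have hfc : Continuous (f : C(GaloisGroupUnramifiedOutside K S, A)) :=
    (f : C(GaloisGroupUnramifiedOutside K S, A)).continuous
  have hd : Continuous d := ρ₀.continuous_smul.comp (continuous_inv.prodMk hfc)
  have hdconst : ∀ {g g' : GaloisGroupUnramifiedOutside K S}, π g = π g' → d g = d g' := by
    intro g g' h
    have hmem := mul_inv_mem_galoisGroupAbove_of_eq S hS κ h
    have hf := (mem_coind_iff ((ρ₀.restrict (galoisGroupAboveSubtype S κ.kerSubgroup)).restrictScalars ℤ) _).1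
      f.2 ⟨g' * g⁻¹, hmem⟩ g
    have hg' : ((⟨g' * g⁻¹, hmem⟩ : galoisGroupAbove S κ.kerSubgroup) : GaloisGroupUnramifiedOutside K S) * g = g' := by
      change g' * g⁻¹ * g = g'
      rw [inv_mul_cancel_right]
    rw [hg'] at hf
    change d g = ρ₀ g'⁻¹ ((f : C(GaloisGroupUnramifiedOutside K S, A)) g')
    rw [hf]
    change ρ₀ g⁻¹ _ = ρ₀ g'⁻¹ (ρ₀ (g' * g⁻¹) _)
    rw [← Module.End.mul_apply, ← map_mul, ← mul_assoc, inv_mul_cancel, one_mul]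
  -- as a function on `ℤ_p`
  let Fz : ℤ_[p] → A := fun z ↦ d (Function.surjInv hπ z)
  have hFzπ : ∀ g, Fz (π g) = d g := fun g ↦ hdconst (Function.surjInv_eq hπ (π g))
  have hFz : Continuous Fz := by
    rw [(isQuotientMap_neg_liftUnramifiedOutside S hS κ).continuous_iff]
    have : Fz ∘ π = d := funext fun g ↦ hFzπ g
    rw [this]
    exact hd
  -- it is smooth `p`-primary
  have hmem : Fz ∈ bigRepSubmodule 𝒪 p A := by
    refine ⟨exists_isSmoothOfLevel_of_continuous hFz,
      exists_uniform_pow_smul_eq_zero (isCompact_range hFz).finite_of_discrete fun z ↦ ?_⟩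
    obtain ⟨k, hk⟩ := hA (Fz z)
    exact ⟨k, by rw [← natCast_zsmul]; exact_mod_cast hk⟩
  refine ⟨BigRepModule.mk Fz hmem, ?_⟩
  apply Subtype.ext
  ext g
  rw [hF, BigRepModule.mk_apply]
  change ρ₀ g (Fz (π g)) = _
  rw [hFzπ]
  change ρ₀ g (ρ₀ g⁻¹ _) = _
  rw [← Module.End.mul_apply, ← map_mul, mul_inv_cancel, map_one, Module.End.one_apply]

variable [TopologicalSpace (PowerSeries 𝒪)]

/-- **Equivariance**: the Shapiro map intertwines Castella's / Greenberg's action `ρ₀ ⊗ Ψ⁻¹` on `𝐃₁`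
(`(g·Φ)(x) = ρ₀(g)(Φ(x − κ̄ g))`) with Serre's right translation on `M_G^H(A)` (`(g a*)(x) = a*(x g)`).
[cite: Greenberg2006, p. 342 L5–6] [cite: SerreGaloisCohomology1997, I §2.5] [cite: Castella2018, §2.1] -/
theorem shapiroMap_bigRep
    (F : BigRepModule 𝒪 p A →+ coindModule ((ρ₀.restrict (galoisGroupAboveSubtype S κ.kerSubgroup)).restrictScalars ℤ))
    (hF : ∀ (Φ : BigRepModule 𝒪 p A) (g : GaloisGroupUnramifiedOutside K S),
      ((F Φ : coindModule _) : C(GaloisGroupUnramifiedOutside K S, A)) g =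
        ρ₀ g (Φ (-(κ.liftUnramifiedOutside S hS g).toAdd)))
    (g : GaloisGroupUnramifiedOutside K S) (Φ : BigRepModule 𝒪 p A) :
    F (bigRep (κ.liftUnramifiedOutside S hS) ρ₀ g Φ) =
      coindRep ((ρ₀.restrict (galoisGroupAboveSubtype S κ.kerSubgroup)).restrictScalars ℤ) g (F Φ) := by
  apply Subtype.ext
  ext x
  rw [coindRep_apply_apply, hF, hF, bigRep_apply_apply]
  simp only [map_mul, toAdd_mul, neg_add, Module.End.mul_apply, sub_eq_add_neg]

/-- **The model isomorphism `𝐃₁ ≃ M_G^H(A)` as an equivariant continuous additive equivalence** (both modules discrete),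
for `A` `p`-primary. [cite: Greenberg2006, Thm. 3 p. 342 (`𝒟 = Ind_{K_∞/K}(D)`)] [cite: SerreGaloisCohomology1997, I §2.5] -/
theorem exists_shapiro_continuousAddEquiv (hA : ∀ a : A, ∃ n : ℕ, (p ^ n : ℤ) • a = 0) :
    ∃ η : BigRepModule 𝒪 p A ≃ₜ+
        coindModule ((ρ₀.restrict (galoisGroupAboveSubtype S κ.kerSubgroup)).restrictScalars ℤ),
      ∀ (g : GaloisGroupUnramifiedOutside K S) (Φ : BigRepModule 𝒪 p A),
        η (bigRep (κ.liftUnramifiedOutside S hS) ρ₀ g Φ) =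
          coindRep ((ρ₀.restrict (galoisGroupAboveSubtype S κ.kerSubgroup)).restrictScalars ℤ) g (η Φ) := by
  obtain ⟨F, hF⟩ := exists_shapiroMap S hS κ ρ₀
  haveI : DiscreteTopology
      (coindModule ((ρ₀.restrict (galoisGroupAboveSubtype S κ.kerSubgroup)).restrictScalars ℤ)) :=
    discreteTopology_coind _
  let e : BigRepModule 𝒪 p A ≃+
      coindModule ((ρ₀.restrict (galoisGroupAboveSubtype S κ.kerSubgroup)).restrictScalars ℤ) :=
    AddEquiv.ofBijective F ⟨shapiroMap_injective F hF, shapiroMap_surjective hA F hF⟩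
  exact ⟨{ e with
      continuous_toFun := continuous_of_discreteTopology
      continuous_invFun := continuous_of_discreteTopology }, fun g Φ ↦ shapiroMap_bigRep F hF g Φ⟩

end Model

/-! ## §3 `Hⁱ(K_Σ/K, 𝐃₁) ≃+ Hⁱ(K_Σ/K_∞, A)` in every degree, and the vanishing transports -/

section Cohomology

variable {K : Type} [Field K] [NumberField K] (S : Set (HeightOneSpectrum (𝓞 K))) {p : ℕ} [Fact p.Prime]
  (hS : ∀ v : HeightOneSpectrum (𝓞 K), ((p : ℕ) : 𝓞 K) ∈ v.asIdeal → v ∈ S)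
  (κ : ZpExtension K p)
  {𝒪 : Type} [CommRing 𝒪] [TopologicalSpace 𝒪] [TopologicalSpace (PowerSeries 𝒪)]
  {A : Type} [AddCommGroup A] [Module 𝒪 A] [TopologicalSpace A] [DiscreteTopology A] [ContinuousSMul 𝒪 A]
  [ContinuousSMul (PowerSeries 𝒪) (BigRepModule 𝒪 p A)]
  (ρ₀ : ContinuousRep (GaloisGroupUnramifiedOutside K S) 𝒪 A)

/-- **Greenberg 2006 Thm. 3 for ONE `ℤ_p`-extension, every degree (Λ-free): `Hⁱ(K_Σ/K, 𝐃₁) ≃+ Hⁱ(K_Σ/K_∞, A)`** for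
the one-variable deformation `𝐃₁ = bigRep κ̄ ρ₀` of a discrete `p`-primary `𝒪`-module `A` with a continuous
`𝒪`-linear `G_{K,S}`-action, `K_∞ = K̄^{ker κ}`, `Hⁱ(K_Σ/K_∞, A) := Hⁱ(galoisGroupAbove S κ.kerSubgroup, ρ₀|)`. Chain
(as in the two-variable `thm3_twistDeformation_cohomology_addEquiv_holds`): transport along the model isomorphism
`𝐃₁ ≃ M_G^H(A)` across the scalars `𝒪⟦T⟧`/`ℤ` (`ContinuousRep.HAddEquivOfContinuousAddEquiv`) ∘ Serre's Shapiro
isomorphism for the closed subgroup `H` of the profinite `G_{K,S}` (`shapiroAddEquiv`) ∘ `ℤ ↝ 𝒪` on `H`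
(`ContinuousRep.restrictScalarsH`). [cite: Greenberg2006, Thm. 3 p. 342 L13–14]
[cite: Lim2012PoitouTate, Prop. 5.2.2 and Lemma 5.3.1] [cite: SerreGaloisCohomology1997, I §2.5 Prop. 10] -/
theorem nonempty_H_bigRep_addEquiv_above (hA : ∀ a : A, ∃ n : ℕ, (p ^ n : ℤ) • a = 0) (i : ℕ) :
    Nonempty ((bigRep (κ.liftUnramifiedOutside S hS) ρ₀).H i ≃+
      (ρ₀.restrict (galoisGroupAboveSubtype S κ.kerSubgroup)).H i) := by
  haveI : IsClosed ((galoisGroupAbove S κ.kerSubgroup : Subgroup (GaloisGroupUnramifiedOutside K S)) :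
      Set (GaloisGroupUnramifiedOutside K S)) := isClosed_galoisGroupAbove_kerSubgroup S κ
  haveI : TotallyDisconnectedSpace (GaloisGroupUnramifiedOutside K S) :=
    totallyDisconnectedSpace_galoisGroupUnramifiedOutside S
  haveI : DiscreteTopology
      (coindModule ((ρ₀.restrict (galoisGroupAboveSubtype S κ.kerSubgroup)).restrictScalars ℤ)) :=
    discreteTopology_coind _
  obtain ⟨η, hη⟩ := exists_shapiro_continuousAddEquiv (S := S) (hS := hS) (κ := κ) (ρ₀ := ρ₀) hA
  -- (1) transport along the model isomorphism, across the two coefficient rings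
  have e₁ : (bigRep (κ.liftUnramifiedOutside S hS) ρ₀).H i ≃+
      (coindRep ((ρ₀.restrict (galoisGroupAboveSubtype S κ.kerSubgroup)).restrictScalars ℤ)).H i :=
    ContinuousRep.HAddEquivOfContinuousAddEquiv (bigRep (κ.liftUnramifiedOutside S hS) ρ₀)
      (coindRep ((ρ₀.restrict (galoisGroupAboveSubtype S κ.kerSubgroup)).restrictScalars ℤ)) η hη i
  -- (2) Shapiro over `ℤ`
  have e₂ : (coindRep ((ρ₀.restrict (galoisGroupAboveSubtype S κ.kerSubgroup)).restrictScalars ℤ)).H i ≃+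
      ((ρ₀.restrict (galoisGroupAboveSubtype S κ.kerSubgroup)).restrictScalars ℤ).H i :=
    shapiroAddEquiv ((ρ₀.restrict (galoisGroupAboveSubtype S κ.kerSubgroup)).restrictScalars ℤ) i
  -- (3) `ℤ ↝ 𝒪` on `H`
  have e₃ : ((ρ₀.restrict (galoisGroupAboveSubtype S κ.kerSubgroup)).restrictScalars ℤ).H i ≃+
      (ρ₀.restrict (galoisGroupAboveSubtype S κ.kerSubgroup)).H i :=
    ContinuousRep.restrictScalarsH ℤ (ρ₀.restrict (galoisGroupAboveSubtype S κ.kerSubgroup)) i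
  exact ⟨e₁.trans (e₂.trans e₃)⟩

/-- **Vanishing descends the tower**: `Hⁱ(K_Σ/K, 𝐃₁) = 0 ⟹ Hⁱ(K_Σ/K_∞, A) = 0` (the direction the V21 road needs:
the cell's `K`-side statements about `bigRep κ̄ ρ₀` give `Hⁱ(Gal(K_Σ/K_∞), A) = 0`).
[cite: Greenberg2006, Thm. 3 p. 342] [cite: Lim2012PoitouTate, Prop. 5.2.2, Lemma 5.3.1] -/
theorem subsingleton_H_above_of_subsingleton_H_bigRep (hA : ∀ a : A, ∃ n : ℕ, (p ^ n : ℤ) • a = 0) (i : ℕ)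
    (h : Subsingleton ((bigRep (κ.liftUnramifiedOutside S hS) ρ₀).H i)) :
    Subsingleton ((ρ₀.restrict (galoisGroupAboveSubtype S κ.kerSubgroup)).H i) := by
  obtain ⟨e⟩ := nonempty_H_bigRep_addEquiv_above S hS κ ρ₀ hA i
  exact e.symm.toEquiv.subsingleton

/-- … and conversely; together: `Hⁱ(K_Σ/K_∞, A) = 0 ↔ Hⁱ(K_Σ/K, 𝐃₁) = 0`.
[cite: Greenberg2006, Thm. 3 p. 342] [cite: Lim2012PoitouTate, Prop. 5.2.2, Lemma 5.3.1] -/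
theorem subsingleton_H_above_iff_subsingleton_H_bigRep (hA : ∀ a : A, ∃ n : ℕ, (p ^ n : ℤ) • a = 0) (i : ℕ) :
    Subsingleton ((ρ₀.restrict (galoisGroupAboveSubtype S κ.kerSubgroup)).H i) ↔
      Subsingleton ((bigRep (κ.liftUnramifiedOutside S hS) ρ₀).H i) := by
  obtain ⟨e⟩ := nonempty_H_bigRep_addEquiv_above S hS κ ρ₀ hA i
  exact ⟨fun _ ↦ e.toEquiv.subsingleton, fun _ ↦ e.symm.toEquiv.subsingleton⟩

end Cohomology

end Summit.BirchSwinnertonDyer.BirchSwinnertonDyer.Theorems.AcTwistDeformationShapiroH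

end
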